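import Summits.NavierStokesRegularity.NavierStokesRegularity.Theorems.DssFarFieldSlavingBlowupTypeIDssProfileDoubleConeShellGap
import Summits.NavierStokesRegularity.NavierStokesRegularity.Theorems.AxisTwistDoorAveragedConeLiouvilleRegularShell
import Literature.Analysis.FluidPDE.VorticityDoubleConeRegularityReduction
import Literature.Analysis.FluidPDE.SuitableWeakInBallTools
import Literature.Analysis.FluidPDE.SingularSetRescaling
import HarnessLib

/-!
# A5 input (Lei–Ren–Tian 2025, Thm 1.1), piece P1b: A REGULAR FLAT PARABOLIC SHELL UP TO THE LID (qualitative)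

Cell pub/ns-inputs, TABLE A row A5 (`LeiRenTian2025_doubleCone_regularity`), recon memo `kits/A5-recon-ser-b.md` cut P1
(ns-in-lit-a5 g0's key «P1 = ser-b»).  Second brick toward `DoubleCone.Shell.exists_uniform_flatShell`.

For `(u, p)` in Albritton–Barker's class on a parabolic ball `Q(0, R)` (`IsSuitableWeakSolutionInBall R 0 u p`), a box
`[−ρ₀², 0] × B̄(0, ρ₀)` with `ρ₀ < R`, and an interval of gauge values `α < β`:

* `isParabolicNull_lidSingularSet_of_inBall_radius` — CKN's Theorem B on the lid `{0} × B̄(0, ρ₀)` for the class on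
  `Q(0, R)` (the tree's `LidPartialRegularity.isParabolicNull_lidSingularSet_of_inBall`, stated on `Q₁(z₀)`, transported
  by the parabolic zoom `IsSuitableWeakSolutionInBall.zoom`, `LeiRenTian2025.isBackwardSingularPoint_zoom_iff`,
  `IsParabolicNull.image_stAffine`).
* `exists_regular_gaugeShell` — there are `a`, `η > 0` with `α < a − η < a + η < β` such that every point `w` of the box
  whose FLAT PARABOLIC GAUGE `ϱ(w) = max(|x_h|, |x₃|, √(−t))` lies in `[a − η, a + η]` is an interior regular point
  (`t < 0`) or a backward-regular lid point (`t = 0`).  I.e. the closed flat parabolic shell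
  `cl 𝒬(a+η) ∖ 𝒬(a−η)` — lateral part, `x₃`-caps and the initial time layer — is free of singular points, up to the
  lid.  Proof = `RegularShell.exists_regular_shell` (26889 programme R2, p637873) VERBATIM with the gauge gap lemma
  `exists_gauge_gap_of_isParabolicNull` (piece P1a) in place of the radial one: the interior singular points of the box
  (`ckn_partial_regularity_holds`) and the backward-singular lid points form a compact `𝒫¹`-null set.

* `exists_uniform_local_bound` — compactness bookkeeping: ONE radius `r₁` and ONE level `M < ∞` such that `|u| ≤ M`
  a.e. on the backward cylinder `Q((t + h, x), r₁)` about every slightly RAISED point `(t, x)`, `t < 0`, of the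
  compact regular gauge shell (finite subcover by centred cylinders of essential boundedness) — the form the
  quantitative persistence lemma of piece P1c consumes.

This is Lei–Ren–Tian's "it is not difficult to show that … there exist numbers `a ∈ (2/3, 3/4)`, `δ ∈ (0, 1/10)` such that
`v` is regular in the space-time closure of the parabolic shell `Q(a+δ) ∖ Q(a−δ)`" (arXiv:2501.08976 p. 6), for flat
cylinders and up to the lid; the UNIFORM version (their Lemma 2.4 as consumed in §4) follows by compactness in piece P1c.

WHAT THIS IS NOT: not a statement about Navier–Stokes regularity (a property of ARBITRARY suitable weak solutions, re-proving
a PRINTED partial-regularity remark); items 0155 / 15453 and the summit stay OPEN.  Theorems only.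
`--supports stmt-NavierStokesRegularity-0155 --as helper`.
[cite: LeiRenTian2025, §2.2 before Lemma 2.4 (arXiv:2501.08976 p. 6)] [cite: CaffarelliKohnNirenberg1982, Theorem B, §6]
-/

noncomputable section

set_option linter.dupNamespace false

namespace Summit.NavierStokesRegularity.NavierStokesRegularity.Theorems.DoubleCone.Shell

open scoped ENNReal NNReal Topology
open Set Function MeasureTheory Metric Filter
open Literature.Analysis.FluidPDE
open Summit.NavierStokesRegularity.NavierStokesRegularity.Theorems.AveragedConeLiouville.LidPartialRegularity
open Summit.NavierStokesRegularity.NavierStokesRegularity.Theorems.AveragedConeLiouville.RegularShell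

/-! ### Theorem B on the lid of `Q(0, R)` -/

/-- **CKN's Theorem B on the lid, any radius.**  For `(u, p)` in Albritton–Barker's class on `Q(0, R)` and `ρ₀ < R`, the
backward-singular points of `u` on the lid `{0} × B̄(0, ρ₀)` form a `𝒫¹`-null set.  (Zoom `U = R u(R²s, Ry)` is in the
class on `Q(0,1)`; its lid singular set on `B̄(0, ρ₀/R)` is null by the unit-radius statement; the dilation
`(s, y) ↦ (R²s, Ry)` maps it onto ours and preserves `𝒫¹`-nullity.)
[cite: CaffarelliKohnNirenberg1982, Theorem B and §6; RobinsonRodrigoSadowski2016, Thm. 16.2] -/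
theorem isParabolicNull_lidSingularSet_of_inBall_radius
    {u : ℝ → EuclideanSpace ℝ (Fin 3) → EuclideanSpace ℝ (Fin 3)} {p : ℝ → EuclideanSpace ℝ (Fin 3) → ℝ} {R : ℝ}
    (hIB : IsSuitableWeakSolutionInBall R (0 : ℝ × EuclideanSpace ℝ (Fin 3)) u p) (hR : 0 < R) {ρ₀ : ℝ}
    (hρ₀ : ρ₀ < R) :
    IsParabolicNull 1 {w : ℝ × EuclideanSpace ℝ (Fin 3) |
      w.1 = 0 ∧ w.2 ∈ closedBall (0 : EuclideanSpace ℝ (Fin 3)) ρ₀ ∧ IsBackwardSingularPoint u w} := by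
  -- the zoomed pair on `Q(0, 1)`
  have hZ := hIB.zoom hR
  simp only [Prod.fst_zero, Prod.snd_zero] at hZ
  have hρR : ρ₀ / R < 1 := by rw [div_lt_one hR]; exact hρ₀
  have hT := isParabolicNull_lidSingularSet_of_inBall hZ hρR
  simp only [Prod.fst_zero, Prod.snd_zero] at hT
  -- our set is the image of the zoomed lid singular set under the dilation
  have himg := hT.image_stAffine (pow_pos hR 2) hR (0 : ℝ) (0 : EuclideanSpace ℝ (Fin 3))
  refine himg.mono ?_
  rintro ⟨t, x⟩ ⟨ht, hx, hsing⟩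
  simp only at ht hx
  refine ⟨(0, R⁻¹ • x), ⟨rfl, ?_, ?_⟩, ?_⟩
  · rw [mem_closedBall_zero_iff] at hx ⊢
    rw [norm_smul, norm_inv, Real.norm_of_nonneg hR.le, le_div_iff₀ hR]
    calc R⁻¹ * ‖x‖ * R = ‖x‖ := by field_simp
      _ ≤ ρ₀ := hx
  · rw [LeiRenTian2025.isBackwardSingularPoint_zoom_iff hR]
    have e : stAffine (R ^ 2) R 0 0 ((0 : ℝ), R⁻¹ • x) = ((t, x) : ℝ × EuclideanSpace ℝ (Fin 3)) := by
      rw [stAffine_apply, ht, smul_smul, mul_inv_cancel₀ hR.ne', one_smul]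
      simp
    rw [e]; exact hsing
  · rw [stAffine_apply, ht, smul_smul, mul_inv_cancel₀ hR.ne', one_smul]
    simp

/-! ### The regular flat parabolic shell -/

/-- **A regular flat parabolic shell, up to the lid.**  For `(u, p)` in Albritton–Barker's class on `Q(0, R)`, a box
radius `0 < ρ₀ < R` and an interval `α < β`, there are `a`, `η > 0` with `α < a − η < a + η < β` such that every point
`w = (t, x)` with `−ρ₀² ≤ t ≤ 0`, `‖x‖ ≤ ρ₀` and `a − η ≤ ϱ(w) ≤ a + η`, `ϱ(t, x) = max(|x_h|, |x₃|, √(−t))` the flat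
parabolic gauge, is an interior regular point (`t < 0`, centred sense) or a backward-regular lid point (`t = 0`).
[cite: LeiRenTian2025, §2.2 before Lemma 2.4 (arXiv:2501.08976 p. 6)] [cite: CaffarelliKohnNirenberg1982, Theorem B] -/
theorem exists_regular_gaugeShell
    {u : ℝ → EuclideanSpace ℝ (Fin 3) → EuclideanSpace ℝ (Fin 3)} {p : ℝ → EuclideanSpace ℝ (Fin 3) → ℝ} {R : ℝ}
    (hIB : IsSuitableWeakSolutionInBall R (0 : ℝ × EuclideanSpace ℝ (Fin 3)) u p) {ρ₀ : ℝ} (hρ₀ : 0 < ρ₀)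
    (hρ₀R : ρ₀ < R) {α β : ℝ} (hαβ : α < β) :
    ∃ a η : ℝ, 0 < η ∧ α < a - η ∧ a + η < β ∧
      ∀ w : ℝ × EuclideanSpace ℝ (Fin 3), -ρ₀ ^ 2 ≤ w.1 → w.1 ≤ 0 → ‖w.2‖ ≤ ρ₀ →
        a - η ≤ max (max (cylRadius w.2) |w.2 2|) (Real.sqrt (-w.1)) →
        max (max (cylRadius w.2) |w.2 2|) (Real.sqrt (-w.1)) ≤ a + η →
        (w.1 < 0 → IsRegularPoint u w) ∧ (w.1 = 0 → ¬ IsBackwardSingularPoint u w) := by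
  -- adapted from `…AveragedConeLiouvilleRegularShell.exists_regular_shell` (radial gauge ↦ flat parabolic gauge)
  have hR : 0 < R := hρ₀.trans hρ₀R
  set B : Set (ℝ × EuclideanSpace ℝ (Fin 3)) := Icc (-ρ₀ ^ 2) 0 ×ˢ closedBall 0 ρ₀ with hB
  have hBc : IsCompact B := isCompact_Icc.prod (isCompact_closedBall _ _)
  have hBcl : IsClosed B := hBc.isClosed
  set Q₁ : Set (ℝ × EuclideanSpace ℝ (Fin 3)) := parabolicCylinder R (0 : ℝ × EuclideanSpace ℝ (Fin 3)) with hQ₁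
  have hBQ : ∀ w ∈ B, w.1 < 0 → w ∈ Q₁ := by
    rintro ⟨t, y⟩ ⟨ht, hy⟩ hneg
    rw [hQ₁, mem_parabolicCylinder]
    simp only [mem_Icc, mem_closedBall, Prod.fst_zero, Prod.snd_zero] at ht hy hneg ⊢
    have hρ2 : ρ₀ ^ 2 < R ^ 2 := by nlinarith
    exact ⟨⟨by linarith [ht.1], hneg⟩, lt_of_le_of_lt hy hρ₀R⟩
  set S₁ : Set (ℝ × EuclideanSpace ℝ (Fin 3)) := {w | w ∈ B ∧ w.1 < 0 ∧ ¬ IsRegularPoint u w} with hS₁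
  set S₂ : Set (ℝ × EuclideanSpace ℝ (Fin 3)) :=
    {w | w.1 = 0 ∧ w.2 ∈ closedBall (0 : EuclideanSpace ℝ (Fin 3)) ρ₀ ∧ IsBackwardSingularPoint u w} with hS₂
  -- both are `𝒫¹`-null
  have hS₁null : IsParabolicNull 1 S₁ := by
    have hckn := ckn_partial_regularity_holds (parabolicCylinderOpens R (0 : ℝ × EuclideanSpace ℝ (Fin 3)))
      one_pos hIB.1 (isCKNForceOn_zero _)
    refine hckn.mono fun w hw => ?_
    exact ⟨hBQ w hw.1 hw.2.1, hw.2.2⟩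
  have hS₂null : IsParabolicNull 1 S₂ := isParabolicNull_lidSingularSet_of_inBall_radius hIB hR hρ₀R
  have hSnull : IsParabolicNull 1 (S₁ ∪ S₂) := by
    have h := parabolicHausdorff_union_le_holds 1 S₁ S₂
    rw [hS₁null, hS₂null, add_zero] at h
    exact le_antisymm h bot_le
  -- backward regularity at a lid point spreads to nearby lid points and to interior points just below
  have hlid_nbhd : ∀ (x : EuclideanSpace ℝ (Fin 3)) (r : ℝ), 0 < r →
      eLpNorm (uncurry u) ∞ (volume.restrict (parabolicCylinder r (((0 : ℝ), x) : ℝ × EuclideanSpace ℝ (Fin 3)))) ≠ ∞ →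
      (∀ x' : EuclideanSpace ℝ (Fin 3), dist x' x < r / 2 → ¬ IsBackwardSingularPoint u ((0 : ℝ), x')) ∧
      (∀ (t' : ℝ) (x' : EuclideanSpace ℝ (Fin 3)), 0 - r ^ 2 / 2 < t' → t' < 0 → dist x' x < r / 2 →
        IsRegularPoint u (t', x')) := by
    intro x r hr hfin
    refine ⟨fun x' hx' hsing => ?_, fun t' x' ht'1 ht'2 hx' => ?_⟩
    · have h1 := hsing (r / 2) (by positivity)
      have h2 : eLpNorm (uncurry u) ∞ (volume.restrict (parabolicCylinder (r / 2)
          (((0 : ℝ), x') : ℝ × EuclideanSpace ℝ (Fin 3)))) ≤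
          eLpNorm (uncurry u) ∞ (volume.restrict (parabolicCylinder r (((0 : ℝ), x) : ℝ × EuclideanSpace ℝ (Fin 3)))) :=
        eLpNorm_mono_measure _ (Measure.restrict_mono_set _ (parabolicCylinder_half_subset hx'))
      rw [h1] at h2
      exact hfin (top_le_iff.1 h2)
    · refine ⟨Real.sqrt ((0 - t') / 2), Real.sqrt_pos.2 (by linarith), ?_⟩
      have hsub := parabolicCylinderCentered_subset_of_below (T := 0) (x := x) hr ht'1 ht'2 hx'
      exact lt_of_le_of_lt (eLpNorm_mono_measure _ (Measure.restrict_mono_set _ hsub)) (lt_top_iff_ne_top.2 hfin)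
  -- the union is closed
  have hclosed : IsClosed (S₁ ∪ S₂) := by
    refine isClosed_of_closure_subset fun w hw => ?_
    rw [closure_union] at hw
    have hS₁B : S₁ ⊆ B := fun w hw => hw.1
    have hS₂B : S₂ ⊆ B := by
      rintro ⟨t, y⟩ ⟨ht, hy, -⟩
      simp only at ht hy
      refine ⟨?_, hy⟩
      rw [ht]; exact ⟨by nlinarith, le_rfl⟩
    have hwB : w ∈ B := by
      rcases hw with hw | hw
      · exact hBcl.closure_subset_iff.2 hS₁B hw
      · exact hBcl.closure_subset_iff.2 hS₂B hw
    obtain ⟨⟨hw1, hw2⟩, hwx⟩ := hwB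
    rcases hw with hw | hw
    · rcases lt_or_eq_of_le hw2 with hneg | hzero
      · left
        refine ⟨⟨⟨hw1, hw2⟩, hwx⟩, hneg, ?_⟩
        have hsub : S₁ ⊆ singularSet u Q₁ := fun w' hw' => ⟨hBQ w' hw'.1 hw'.2.1, hw'.2.2⟩
        have hmem : w ∈ closure (singularSet u Q₁) ∩ Q₁ :=
          ⟨closure_mono hsub hw, hBQ w ⟨⟨hw1, hw2⟩, hwx⟩ hneg⟩
        exact (closure_singularSet_inter_subset u Q₁ hmem).2
      · right
        refine ⟨hzero, hwx, ?_⟩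
        intro r hr
        by_contra hfin
        obtain ⟨-, hbelow⟩ := hlid_nbhd w.2 r hr (by rwa [show (((0 : ℝ), w.2) : ℝ × EuclideanSpace ℝ (Fin 3)) = w from
          Prod.ext hzero.symm rfl])
        obtain ⟨w', hw'S, hw'd⟩ := Metric.mem_closure_iff.1 hw (min (r ^ 2 / 2) (r / 2)) (by positivity)
        rw [dist_comm, Prod.dist_eq, max_lt_iff, Real.dist_eq] at hw'd
        obtain ⟨hd1, hd2⟩ := hw'd
        have hd1' : |w'.1 - w.1| < r ^ 2 / 2 := hd1.trans_le (min_le_left _ _)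
        have hd2' : dist w'.2 w.2 < r / 2 := hd2.trans_le (min_le_right _ _)
        rw [hzero] at hd1'
        have ht'1 : 0 - r ^ 2 / 2 < w'.1 := by
          have := (abs_lt.1 hd1').1; linarith
        exact hw'S.2.2 (by
          have := hbelow w'.1 w'.2 ht'1 hw'S.2.1 hd2'
          simpa only [Prod.mk.eta] using this)
    · right
      have hS₂cl : S₂ ⊆ {w : ℝ × EuclideanSpace ℝ (Fin 3) | w.1 = 0} := fun w hw => hw.1
      have hzero : w.1 = 0 :=
        (isClosed_eq continuous_fst continuous_const).closure_subset_iff.2 hS₂cl hw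
      refine ⟨hzero, hwx, ?_⟩
      intro r hr
      by_contra hfin
      obtain ⟨hnear, -⟩ := hlid_nbhd w.2 r hr (by rwa [show (((0 : ℝ), w.2) : ℝ × EuclideanSpace ℝ (Fin 3)) = w from
        Prod.ext hzero.symm rfl])
      obtain ⟨w', hw'S, hw'd⟩ := Metric.mem_closure_iff.1 hw (r / 2) (by positivity)
      rw [dist_comm, Prod.dist_eq, max_lt_iff] at hw'd
      have : w' = (((0 : ℝ), w'.2) : ℝ × EuclideanSpace ℝ (Fin 3)) := Prod.ext hw'S.1 rfl
      exact hnear w'.2 hw'd.2 (this ▸ hw'S.2.2)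
  have hScomp : IsCompact (S₁ ∪ S₂) := by
    refine hBc.of_isClosed_subset hclosed ?_
    rintro w (hw | hw)
    · exact hw.1
    · obtain ⟨ht, hy, -⟩ := hw
      refine ⟨?_, hy⟩
      rw [ht]; exact ⟨by nlinarith, le_rfl⟩
  -- the gap in the values of the gauge
  obtain ⟨a, η, hη, h1, h2, hgap⟩ := exists_gauge_gap_of_isParabolicNull hScomp hSnull hαβ
  refine ⟨a, η, hη, h1, h2, fun w hw1 hw2 hwx hg1 hg2 => ⟨fun hneg => ?_, fun hzero hsing => ?_⟩⟩
  · by_contra hreg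
    have hmem : w ∈ S₁ ∪ S₂ := Or.inl ⟨⟨⟨hw1, hw2⟩, mem_closedBall_zero_iff.2 hwx⟩, hneg, hreg⟩
    rcases hgap _ hmem with h | h
    · linarith
    · linarith
  · have hmem : w ∈ S₁ ∪ S₂ := Or.inr ⟨hzero, mem_closedBall_zero_iff.2 hwx, hsing⟩
    rcases hgap _ hmem with h | h
    · linarith
    · linarith


/-! ### Uniform local bounds near the compact regular shell -/

/-- **Uniform local essential bounds below the regular shell.**  In the situation of `exists_regular_gaugeShell` (every
point of the compact gauge shell `K = {−ρ₀² ≤ t ≤ 0, ‖x‖ ≤ ρ₀, a − η ≤ ϱ ≤ a + η}` is interior-regular or lid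
backward-regular) there are ONE radius `0 < r₁ ≤ r₀` and ONE level `M < ∞` such that for every point `y = (t, x)` of
`K` with `t < 0` and every rise `0 < h ≤ min(−t, r₁²)`, `|u| ≤ M` a.e. on the backward cylinder `Q((t + h, x), r₁)`
about the RAISED vertex (which contains `y` as soon as `h` is small against the radius).  Proof: the centred cylinders
`Q*_{r_w/2}(w)`, `w ∈ K`, `r_w` a radius of (backward) essential boundedness at `w`, cover the compact `K`; take a
finite subcover, `r₁ = min r_w/2`, `M = Σ ‖u‖_{L^∞}`. [folklore; cf. AlbrittonBarker2019 Prop. 2.3] -/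
theorem exists_uniform_local_bound
    {u : ℝ → EuclideanSpace ℝ (Fin 3) → EuclideanSpace ℝ (Fin 3)} {ρ₀ a η : ℝ}
    (hreg : ∀ w : ℝ × EuclideanSpace ℝ (Fin 3), -ρ₀ ^ 2 ≤ w.1 → w.1 ≤ 0 → ‖w.2‖ ≤ ρ₀ →
        a - η ≤ max (max (cylRadius w.2) |w.2 2|) (Real.sqrt (-w.1)) →
        max (max (cylRadius w.2) |w.2 2|) (Real.sqrt (-w.1)) ≤ a + η →
        (w.1 < 0 → IsRegularPoint u w) ∧ (w.1 = 0 → ¬ IsBackwardSingularPoint u w))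
    {r₀ : ℝ} (hr₀ : 0 < r₀) :
    ∃ (r₁ : ℝ) (M : ℝ≥0∞), 0 < r₁ ∧ r₁ ≤ r₀ ∧ M ≠ ∞ ∧
      ∀ y : ℝ × EuclideanSpace ℝ (Fin 3), -ρ₀ ^ 2 ≤ y.1 → y.1 < 0 → ‖y.2‖ ≤ ρ₀ →
        a - η ≤ max (max (cylRadius y.2) |y.2 2|) (Real.sqrt (-y.1)) →
        max (max (cylRadius y.2) |y.2 2|) (Real.sqrt (-y.1)) ≤ a + η →
        ∀ h : ℝ, 0 < h → h ≤ -y.1 → h ≤ r₁ ^ 2 →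
          ∀ᵐ w ∂(volume.restrict (parabolicCylinder r₁ ((y.1 + h, y.2) : ℝ × EuclideanSpace ℝ (Fin 3)))),
            ‖u w.1 w.2‖ₑ ≤ M := by
  -- the compact gauge shell
  set g : ℝ × EuclideanSpace ℝ (Fin 3) → ℝ := fun w => max (max (cylRadius w.2) |w.2 2|) (Real.sqrt (-w.1))
    with hg
  set K : Set (ℝ × EuclideanSpace ℝ (Fin 3)) :=
    {w | w ∈ Icc (-ρ₀ ^ 2) 0 ×ˢ closedBall (0 : EuclideanSpace ℝ (Fin 3)) ρ₀ ∧ a - η ≤ g w ∧ g w ≤ a + η} with hK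
  have hKc : IsCompact K := by
    have hbox : IsCompact (Icc (-ρ₀ ^ 2) 0 ×ˢ closedBall (0 : EuclideanSpace ℝ (Fin 3)) ρ₀) :=
      isCompact_Icc.prod (isCompact_closedBall _ _)
    have hcl : IsClosed {w : ℝ × EuclideanSpace ℝ (Fin 3) | a - η ≤ g w ∧ g w ≤ a + η} :=
      (isClosed_le continuous_const continuous_gauge).inter (isClosed_le continuous_gauge continuous_const)
    have e : K = Icc (-ρ₀ ^ 2) 0 ×ˢ closedBall (0 : EuclideanSpace ℝ (Fin 3)) ρ₀ ∩
        {w | a - η ≤ g w ∧ g w ≤ a + η} := by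
      ext w; simp only [hK, mem_setOf_eq, mem_inter_iff]
    rw [e]
    exact hbox.inter_right hcl
  -- the local data at a point of `K`: a radius `r` and a finite level `N` controlling `u` below nearby points
  have hloc : ∀ w ∈ K, ∃ (r : ℝ) (N : ℝ≥0∞), 0 < r ∧ N ≠ ∞ ∧
      ∀ y : ℝ × EuclideanSpace ℝ (Fin 3), y ∈ parabolicCylinderCentered (r / 2) w → y.1 < 0 →
        ∀ h : ℝ, 0 < h → h ≤ -y.1 → h ≤ (r / 2) ^ 2 → ∀ r₁ : ℝ, 0 < r₁ → r₁ ≤ r / 2 →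
          ∀ᵐ w' ∂(volume.restrict (parabolicCylinder r₁ ((y.1 + h, y.2) : ℝ × EuclideanSpace ℝ (Fin 3)))),
            ‖u w'.1 w'.2‖ₑ ≤ N := by
    rintro w ⟨⟨⟨hw1, hw2⟩, hwx⟩, hg1, hg2⟩
    rw [mem_closedBall_zero_iff] at hwx
    obtain ⟨hint, hlid⟩ := hreg w hw1 hw2 hwx hg1 hg2
    rcases lt_or_eq_of_le hw2 with hneg | hzero
    · -- interior point: bounded on a centred cylinder `Q*_r(w)`
      obtain ⟨r, hr, hfin⟩ := hint hneg
      set N : ℝ≥0∞ := eLpNorm (uncurry u) ∞ (volume.restrict (parabolicCylinderCentered r w)) with hN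
      refine ⟨r, N, hr, hfin.ne, fun y hy hy0 h hh hhy hhr r₁ hr₁ hr₁r => ?_⟩
      have hae : ∀ᵐ w' ∂(volume.restrict (parabolicCylinderCentered r w)), ‖u w'.1 w'.2‖ₑ ≤ N := by
        have h0 := ae_le_eLpNormEssSup (μ := volume.restrict (parabolicCylinderCentered r w)) (f := uncurry u)
        rw [hN, eLpNorm_exponent_top]
        filter_upwards [h0] with w' hw'
        exact hw'
      refine ae_restrict_of_ae_restrict_of_subset ?_ hae
      rw [mem_parabolicCylinderCentered] at hy
      obtain ⟨⟨hy1, hy2⟩, hyx⟩ := hy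
      rintro ⟨τ, ξ⟩ hτ
      rw [mem_parabolicCylinder] at hτ
      rw [mem_parabolicCylinderCentered]
      obtain ⟨⟨hτ1, hτ2⟩, hξ⟩ := hτ
      simp only at hτ1 hτ2 hξ ⊢
      have hr2 : r₁ ^ 2 ≤ (r / 2) ^ 2 := pow_le_pow_left₀ hr₁.le hr₁r 2
      refine ⟨⟨by nlinarith, by nlinarith⟩, ?_⟩
      calc dist ξ w.2 ≤ dist ξ y.2 + dist y.2 w.2 := dist_triangle _ _ _
        _ < r₁ + r / 2 := add_lt_add hξ hyx
        _ ≤ r := by linarith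
    · -- lid point: bounded on a backward cylinder `Q(w, r)`
      have hns := hlid hzero
      simp only [IsBackwardSingularPoint, not_forall] at hns
      obtain ⟨r, hr, hfin⟩ := hns
      set N : ℝ≥0∞ := eLpNorm (uncurry u) ∞ (volume.restrict (parabolicCylinder r w)) with hN
      refine ⟨r, N, hr, hfin, fun y hy hy0 h hh hhy hhr r₁ hr₁ hr₁r => ?_⟩
      have hae : ∀ᵐ w' ∂(volume.restrict (parabolicCylinder r w)), ‖u w'.1 w'.2‖ₑ ≤ N := by
        have h0 := ae_le_eLpNormEssSup (μ := volume.restrict (parabolicCylinder r w)) (f := uncurry u)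
        rw [hN, eLpNorm_exponent_top]
        filter_upwards [h0] with w' hw'
        exact hw'
      refine ae_restrict_of_ae_restrict_of_subset ?_ hae
      rw [mem_parabolicCylinderCentered] at hy
      obtain ⟨⟨hy1, hy2⟩, hyx⟩ := hy
      rintro ⟨τ, ξ⟩ hτ
      rw [mem_parabolicCylinder] at hτ ⊢
      obtain ⟨⟨hτ1, hτ2⟩, hξ⟩ := hτ
      simp only at hτ1 hτ2 hξ ⊢
      have hr2 : r₁ ^ 2 ≤ (r / 2) ^ 2 := pow_le_pow_left₀ hr₁.le hr₁r 2
      rw [hzero] at hy1 hy2 ⊢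
      refine ⟨⟨by nlinarith, by linarith⟩, ?_⟩
      calc dist ξ w.2 ≤ dist ξ y.2 + dist y.2 w.2 := dist_triangle _ _ _
        _ < r₁ + r / 2 := add_lt_add hξ hyx
        _ ≤ r := by linarith
  choose! r N hr hN hgood using hloc
  -- a finite subcover of `K` by the centred cylinders `Q*_{r_w/2}(w)`
  obtain ⟨J₀, hJ₀K, hJ₀fin, hJ₀⟩ := hKc.elim_finite_subcover_image (b := K)
    (c := fun w => parabolicCylinderCentered (r w / 2) w)
    (fun w _ => isOpen_parabolicCylinderCentered _ _)
    (fun w hw => mem_iUnion₂.2 ⟨w, hw, mem_parabolicCylinderCentered_self (by linarith [hr w hw]) w⟩)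
  set J : Finset (ℝ × EuclideanSpace ℝ (Fin 3)) := hJ₀fin.toFinset with hJdef
  have hJK : ∀ w ∈ J, w ∈ K := fun w hw => hJ₀K (hJ₀fin.mem_toFinset.1 hw)
  have hJ : K ⊆ ⋃ w ∈ J, parabolicCylinderCentered (r w / 2) w := by
    intro y hy
    obtain ⟨w, hw, hyw⟩ := mem_iUnion₂.1 (hJ₀ hy)
    exact mem_iUnion₂.2 ⟨w, hJ₀fin.mem_toFinset.2 hw, hyw⟩
  -- the uniform radius and level
  obtain ⟨r₁, hr₁, hr₁r₀, hr₁J⟩ : ∃ r₁ : ℝ, 0 < r₁ ∧ r₁ ≤ r₀ ∧ ∀ w ∈ J, r₁ ≤ r w / 2 := by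
    rcases J.eq_empty_or_nonempty with hJe | hJne
    · exact ⟨r₀, hr₀, le_rfl, fun w hw => by rw [hJe] at hw; simp at hw⟩
    · refine ⟨min r₀ (J.inf' hJne fun w => r w / 2), lt_min hr₀ ?_, min_le_left _ _, fun w hw =>
        (min_le_right _ _).trans (Finset.inf'_le _ hw)⟩
      rw [Finset.lt_inf'_iff]
      intro w hw
      linarith [hr w (hJK w hw)]
  set M : ℝ≥0∞ := ∑ w ∈ J, N w with hM
  have hMtop : M ≠ ∞ := by
    rw [hM]
    exact ENNReal.sum_ne_top.2 fun w hw => hN w (hJK w hw)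
  have hNM : ∀ w ∈ J, N w ≤ M := fun w hw => by
    rw [hM]; exact Finset.single_le_sum (fun _ _ => zero_le) hw
  refine ⟨r₁, M, hr₁, hr₁r₀, hMtop, fun y hy1 hy2 hyx hg1 hg2 h hh hhy hhr => ?_⟩
  -- `y ∈ K` lies in some `Q*_{r_w/2}(w)`, `w ∈ J`
  have hyK : y ∈ K := ⟨⟨⟨hy1, hy2.le⟩, mem_closedBall_zero_iff.2 hyx⟩, hg1, hg2⟩
  obtain ⟨w, hw, hyw⟩ := mem_iUnion₂.1 (hJ hyK)
  have hwK : w ∈ K := hJK w hw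
  have key := hgood w hwK y hyw hy2 h hh hhy (hhr.trans (pow_le_pow_left₀ hr₁.le (hr₁J w hw) 2)) r₁ hr₁
    (hr₁J w hw)
  filter_upwards [key] with w' hw'
  exact hw'.trans (hNM w hw)

end Summit.NavierStokesRegularity.NavierStokesRegularity.Theorems.DoubleCone.Shell

end
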